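import Summits.CriticalPhenomena.PercolationContinuityZ3.Theorems.SahiMasterFamilyAnnihilatedSlot
import Summits.CriticalPhenomena.PercolationContinuityZ3.Theorems.SahiMasterFamilyFiveStep

/-!
# Sahi positivity at EVERY order on an independent frame, one sandwiched member and one arbitrary member

Unit `prim-master-conj` (crux anchor stmt-CriticalPhenomena-4575); the first application of the block expansion
`SahiMasterFamilyAnnihilatedSlot.lean` (identity (★) of PROOF-ALLK.md).  Let `A_0,…,A_{m−1}` be increasing events with pairwise disjoint essential
supports (an independent frame, `S := ⋃ esupp A_l`), `Y` an increasing event SANDWICHED over the frame — `Y ⊇ K ∩ ⋂_{l≠j} A_l` for every `j`, where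
`K := {ω | ω ∪ S ∈ Y}` is the forced-open hull (this is the explicit form of "`(A, Y)` is a zero flag of order `m+1`", cf.
`suppZeroFlag_iff_disjoint_of_frame` + the sandwich lemma; for `m = 2` it is `Z_3`) — and `D` ANY increasing event.  Then
(`sahiE_ind_nonneg_cons_sandwich_cons`) for every `p ∈ [0,1]^ι`

  `E_{m+2}(μ_p; 1_Y, 1_D, 1_{A_0}, …, 1_{A_{m−1}}) ≥ 0`.

This is the positivity half of the master-conjecture step at every order on cores "frame + one member" (order 4 = `SahiMasterFamilyFourStep`,
the order-5 type-(a) families of `SahiMasterFamilyFiveStep`, the shrunk-frame family (♮) of `SahiMasterFamilyShrunkFramePairwise` — now uniformly in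
the order).  Proof = the v2 architecture of PROOF-ALLK §4 in its simplest instance: write `1_Y = 1_K − 1_N` (`N := K ∖ Y`); `(K, A)` is a frame, so
`E(K, D, A) ≥ 0` (`sahiE_ind_nonneg_of_frame`); expand `E(N, D, A)` by (★): the top term vanishes because `N` misses `⋂ A_l`, and every other term is
`|T|!·μ(N ∩ ⋂_{t∈T}(D,A)_t)·E(sub-family of (D, A)) ≥ 0`, a sub-frame plus at most one free member (`sahiE_ind_nonneg_of_frame_any`).
No conjecture asserted; axioms standard. [this work]
-/

noncomputable section

open scoped Classical

namespace Summit.CriticalPhenomena.PercolationContinuityZ3.Theorems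

open Finset Function MeasureTheory
open Literature.Combinatorics.Sahi2008
open Literature.Probability.Percolation (DeterminedBy)
open Literature.Probability.LatticeModels (prodBernoulli)
open Literature.Probability.LatticeModels.Kahn2022 (Affects)
open Literature.Probability.Percolation.DecisionTree (ind ind_of_mem ind_of_not_mem ind_nonneg)

variable {ι : Type} [Fintype ι]

/-- **Frame positivity at any size**: if the increasing events `G_j`, `j ≠ s`, have pairwise disjoint essential supports then
`0 ≤ E_r(μ_p; 1_G)` (orders `0, 1` trivially; `≥ 2` is `sahiE_ind_nonneg_of_frame`). [this work] -/
theorem sahiE_ind_nonneg_of_frame_any (p : ι → unitInterval) {r : ℕ} (G : Fin r → Set (Set ι)) (hG : ∀ j, IsUpperSet (G j))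
    (s : Fin r) (hd : ∀ j j', j ≠ s → j' ≠ s → j ≠ j' → Disjoint (esupp (G j)) (esupp (G j'))) :
    0 ≤ sahiE (bernoulliWeight p) r (fun j => ind (G j)) := by
  rcases r with _ | _ | n
  · exact s.elim0
  · rw [sahiE_one_apply]; exact ex_ind_nonneg' p _
  · exact sahiE_ind_nonneg_of_frame p G hG s hd

/-- The product of indicators over a finset of slots is the indicator of the intersection (with a prefactor event). [folklore] -/
theorem ex_ind_mul_prod_ind_nonneg (p : ι → unitInterval) {r : ℕ} (N : Set (Set ι)) (R : Fin r → Set (Set ι)) (T : Finset (Fin r)) :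
    ind N * ∏ t ∈ T, ind (R t) = ind (N ∩ ⋂ t ∈ T, R t) ∧ 0 ≤ ex (bernoulliWeight p) (ind N * ∏ t ∈ T, ind (R t)) := by
  have e : ind N * ∏ t ∈ T, ind (R t) = ind (N ∩ ⋂ t ∈ T, R t) := by
    rw [prod_ind_eq_ind_biInter]
    funext ω; exact (Literature.Probability.Percolation.BHK2006.ind_inter _ _ ω).symm
  exact ⟨e, by rw [e]; exact ex_ind_nonneg' p _⟩

/-- **Sahi positivity at every order on "frame + sandwiched member + arbitrary member".**  For increasing events `A_0,…,A_{m−1}` with pairwise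
disjoint essential supports, an increasing event `Y` with `Y ⊇ K ∩ ⋂_{l≠j} A_l` for every `j` (`K = {ω | ω ∪ ⋃_l esupp A_l ∈ Y}` its forced-open
hull), and ANY increasing event `D`:  `0 ≤ E_{m+2}(μ_p; 1_Y, 1_D, 1_{A_0},…,1_{A_{m−1}})` for every `p ∈ [0,1]^ι`. [this work] -/
theorem sahiE_ind_nonneg_cons_sandwich_cons (p : ι → unitInterval) {m : ℕ} (A : Fin m → Set (Set ι)) (hA : ∀ j, IsUpperSet (A j))
    (hdA : ∀ j j', j ≠ j' → Disjoint (esupp (A j)) (esupp (A j'))) {Y D : Set (Set ι)} (hY : IsUpperSet Y) (hD : IsUpperSet D)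
    (hsand : ∀ j : Fin m, (⋂ l ∈ (univ.erase j : Finset (Fin m)), A l) ∩
      {ω : Set ι | ω ∪ ↑(univ.biUnion fun l => esupp (A l)) ∈ Y} ⊆ Y) :
    0 ≤ sahiE (bernoulliWeight p) (m + 2)
      (fun j => ind ((Fin.cons Y (Fin.cons D A : Fin (m + 1) → Set (Set ι)) : Fin (m + 2) → Set (Set ι)) j)) := by
  -- notation
  set S : Finset ι := univ.biUnion fun l => esupp (A l) with hS
  set K : Set (Set ι) := {ω : Set ι | ω ∪ ↑S ∈ Y} with hK
  set R : Fin (m + 1) → Set (Set ι) := Fin.cons D A with hR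
  have hYK : Y ⊆ K := subset_forcedHull hY _
  have hKu : IsUpperSet K := isUpperSet_forcedHull hY _
  have hRu : ∀ t, IsUpperSet (R t) := fun t => by
    refine Fin.cases ?_ (fun i => ?_) t
    · simpa [hR] using hD
    · simpa [hR] using hA i
  have dKA : ∀ i, Disjoint (esupp K) (esupp (A i)) := fun i =>
    Finset.disjoint_left.2 fun e heK heA =>
      not_affects_forcedHull Y (S := (↑S : Set ι)) (mem_coe.2 (mem_biUnion.2 ⟨i, mem_univ i, heA⟩)) (mem_esupp.1 heK)
  -- the key vanishing: `N = K \ Y` misses `⋂ A`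
  have hNA : (K \ Y) ∩ (⋂ l ∈ (univ : Finset (Fin m)), A l) = ∅ := by
    rcases Nat.eq_zero_or_pos m with hm | hm
    · subst hm
      have hKY : K = Y := by
        ext ω
        simp only [hK, Set.mem_setOf_eq]
        have : (S : Finset ι) = ∅ := by simp [hS]
        rw [this, coe_empty, Set.union_empty]
      rw [hKY, Set.sdiff_self, Set.empty_inter]
    · obtain ⟨j⟩ : Nonempty (Fin m) := ⟨⟨0, hm⟩⟩
      ext ω
      simp only [Set.mem_inter_iff, Set.mem_sdiff, Set.mem_empty_iff_false, iff_false, not_and, and_imp]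
      intro hωK hωY hωA
      apply hωY
      refine hsand j ⟨?_, hωK⟩
      simp only [Set.mem_iInter] at hωA ⊢
      exact fun l _ => hωA l (mem_univ l)
  -- the family as `cons (1_Y) rest`, and `1_Y = 1_K − 1_N`
  have hfam : (fun j => ind ((Fin.cons Y R : Fin (m + 2) → Set (Set ι)) j)) =
      (Fin.cons (ind Y) (fun t => ind (R t)) : Fin (m + 2) → Set ι → ℝ) := by
    funext j; refine Fin.cases ?_ (fun t => ?_) j <;> simp
  have hfamK : (fun j => ind ((Fin.cons K R : Fin (m + 2) → Set (Set ι)) j)) =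
      (Fin.cons (ind K) (fun t => ind (R t)) : Fin (m + 2) → Set ι → ℝ) := by
    funext j; refine Fin.cases ?_ (fun t => ?_) j <;> simp
  have hlin : sahiE (bernoulliWeight p) (m + 2) (Fin.cons (ind Y) (fun t => ind (R t)) : Fin (m + 2) → Set ι → ℝ) =
      sahiE (bernoulliWeight p) (m + 2) (Fin.cons (ind K) (fun t => ind (R t)) : Fin (m + 2) → Set ι → ℝ) -
        sahiE (bernoulliWeight p) (m + 2) (Fin.cons (ind (K \ Y)) (fun t => ind (R t)) : Fin (m + 2) → Set ι → ℝ) := by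
    have key := sahiE_update_lin (bernoulliWeight p) (m + 2) (Fin.cons (ind Y) (fun t => ind (R t))) 0 1 (-1) (ind K) (ind (K \ Y))
    simp only [Fin.update_cons_zero] at key
    have e : (1 : ℝ) • ind K + (-1 : ℝ) • ind (K \ Y) = ind Y := by
      rw [ind_diff_eq_sub hYK, one_smul, neg_one_smul]; abel
    rw [e] at key
    rw [key]; ring
  rw [hfam, hlin]
  -- the `K` term: `(K, A)` is a frame, `D` free at slot `1`
  have tK : 0 ≤ sahiE (bernoulliWeight p) (m + 2) (Fin.cons (ind K) (fun t => ind (R t)) : Fin (m + 2) → Set ι → ℝ) := by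
    rw [← hfamK]
    refine sahiE_ind_nonneg_of_frame_any p (Fin.cons K R) ?_ 1 ?_
    · intro j; refine Fin.cases ?_ (fun t => ?_) j
      · simpa using hKu
      · simpa using hRu t
    · intro j j' hj hj' hne
      rcases Fin.eq_zero_or_eq_succ j with rfl | ⟨j₁, rfl⟩ <;> rcases Fin.eq_zero_or_eq_succ j' with rfl | ⟨j₁', rfl⟩
      · exact absurd rfl hne
      · rcases Fin.eq_zero_or_eq_succ j₁' with rfl | ⟨i', rfl⟩
        · exact absurd rfl hj'
        · simp only [Fin.cons_zero, Fin.cons_succ, hR]; exact dKA i'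
      · rcases Fin.eq_zero_or_eq_succ j₁ with rfl | ⟨i, rfl⟩
        · exact absurd rfl hj
        · simp only [Fin.cons_zero, Fin.cons_succ, hR]; exact (dKA i).symm
      · rcases Fin.eq_zero_or_eq_succ j₁ with rfl | ⟨i, rfl⟩
        · exact absurd rfl hj
        rcases Fin.eq_zero_or_eq_succ j₁' with rfl | ⟨i', rfl⟩
        · exact absurd rfl hj'
        simp only [Fin.cons_succ, hR]
        exact hdA i i' fun h => hne (by rw [h])
  -- the `N` term is `≤ 0`: block expansion, vanishing top term, nonnegative remaining terms
  have tN : sahiE (bernoulliWeight p) (m + 2) (Fin.cons (ind (K \ Y)) (fun t => ind (R t)) : Fin (m + 2) → Set ι → ℝ) ≤ 0 := by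
    rw [sahiE_cons_eq_block_expansion]
    have htop : ex (bernoulliWeight p) (ind (K \ Y) * ∏ t, ind (R t)) = 0 := by
      obtain ⟨e, -⟩ := ex_ind_mul_prod_ind_nonneg p (K \ Y) R univ
      rw [e]
      have hsub : (K \ Y) ∩ (⋂ t ∈ (univ : Finset (Fin (m + 1))), R t) ⊆ (K \ Y) ∩ ⋂ l ∈ (univ : Finset (Fin m)), A l := by
        rintro ω ⟨hN, hI⟩
        refine ⟨hN, ?_⟩
        simp only [Set.mem_iInter] at hI ⊢
        intro l _
        have := hI l.succ (mem_univ _)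
        simpa [hR] using this
      rw [Set.eq_empty_of_subset_empty (hsub.trans hNA.subset)]
      exact ex_ind_empty _
    rw [htop, mul_zero, zero_sub, neg_nonpos]
    refine sum_nonneg fun T _ => mul_nonneg (mul_nonneg (Nat.cast_nonneg _) (ex_ind_mul_prod_ind_nonneg p _ R T).2) ?_
    -- the complementary sub-family: some `A`'s and at most one `D` — a frame plus at most one free member
    set s₀ : Finset (Fin (m + 1)) := univ \ T with hs₀
    by_cases h0 : (0 : Fin (m + 1)) ∈ s₀
    · obtain ⟨s, hs⟩ : ∃ s : Fin s₀.card, s₀.orderEmbOfFin rfl s = 0 := by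
        have : (0 : Fin (m + 1)) ∈ Set.range (s₀.orderEmbOfFin rfl) := by rw [range_orderEmbOfFin]; exact h0
        exact this
      refine sahiE_ind_nonneg_of_frame_any p (fun x => R (s₀.orderEmbOfFin rfl x)) (fun x => hRu _) s ?_
      intro x x' hx hx' hne
      have hx0 : s₀.orderEmbOfFin rfl x ≠ 0 := fun h => hx ((s₀.orderEmbOfFin rfl).injective (h.trans hs.symm))
      have hx'0 : s₀.orderEmbOfFin rfl x' ≠ 0 := fun h => hx' ((s₀.orderEmbOfFin rfl).injective (h.trans hs.symm))
      obtain ⟨i, hi⟩ := Fin.exists_succ_eq_of_ne_zero hx0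
      obtain ⟨i', hi'⟩ := Fin.exists_succ_eq_of_ne_zero hx'0
      simp only [← hi, ← hi', hR, Fin.cons_succ]
      refine hdA i i' fun h => hne ((s₀.orderEmbOfFin rfl).injective ?_)
      rw [← hi, ← hi', h]
    · have hpos : 0 < s₀.card := by
        rw [hs₀, card_univ_sdiff, Fintype.card_fin]
        have hT : T.card < m + 1 := by
          have hT' : T ≠ univ := (mem_erase.1 ‹T ∈ univ.powerset.erase univ›).1
          have := card_lt_card (ssubset_univ_iff.2 hT')
          rwa [card_univ, Fintype.card_fin] at this
        omega
      refine sahiE_ind_nonneg_of_frame_any p (fun x => R (s₀.orderEmbOfFin rfl x)) (fun x => hRu _) ⟨0, hpos⟩ ?_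
      intro x x' _ _ hne
      have hx0 : s₀.orderEmbOfFin rfl x ≠ 0 := fun h => h0 (h ▸ orderEmbOfFin_mem _ _ x)
      have hx'0 : s₀.orderEmbOfFin rfl x' ≠ 0 := fun h => h0 (h ▸ orderEmbOfFin_mem _ _ x')
      obtain ⟨i, hi⟩ := Fin.exists_succ_eq_of_ne_zero hx0
      obtain ⟨i', hi'⟩ := Fin.exists_succ_eq_of_ne_zero hx'0
      simp only [← hi, ← hi', hR, Fin.cons_succ]
      refine hdA i i' fun h => hne ((s₀.orderEmbOfFin rfl).injective ?_)
      rw [← hi, ← hi', h]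
  linarith

end Summit.CriticalPhenomena.PercolationContinuityZ3.Theorems
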